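import Literature.Computability.AlgebraicComplexity.BasicTensorSubspaces
import Mathlib.Data.Nat.Choose.Sum
import Mathlib.Data.Finite.Perm
import Mathlib.Data.Fintype.Card
import HarnessLib

/-!
# The polarisation identity for a product of linear forms

Topic `Literature/Computability/AlgebraicComplexity`; companion of `RankMethodBarriers.lean`
(`linearForm`, `rankOneTensor`, `tensorRankD`). The classical identity behind
[GargMakamOliveiraWigderson2019, Example 1.5] ("`x₁ ⋯ x_d` is a sum of `2^{d-1}` powers of linear
forms", after [Glynn]) in its inclusion–exclusion form, valid in every commutative ring:

  `d! · y₁ y₂ ⋯ y_d = ∑_{S ⊆ [d]} (-1)^{d - |S|} (∑_{l ∈ S} y_l)^d`   (`sum_neg_one_pow_mul_sum_pow`).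

Consequently a product of `d` linear forms `ℓ₁ ⋯ ℓ_d ∈ F[x₁, …, x_n]` is, in characteristic zero, a
linear combination of the `2^d` `d`-th powers `(∑_{l ∈ S} ℓ_l)^d` (`prod_linearForm_eq_smul_sum`),
so a linear map `φ` into `k`-tensors (`k ≥ 1`) with `trk φ(ℓ^d) ≤ r` on powers of linear forms has
`trk φ(ℓ₁ ⋯ ℓ_d) ≤ 2^d · r` on products of linear forms (`tensorRankD_map_prod_linearForm_le`) —
the step that reduces GMOW's Theorem 1.16 (forms) to Theorem 1.14 (tensors) in
`Literature.Barriers.ValiantsHypothesis` (file `RankLiftingBarrierForms.lean`).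

Proof of the identity: expand `(∑_{l ∈ S} y_l)^d = ∑_{w : [d] → S} ∏_q y_{w q}`, swap the sums, and
use `∑_{S ⊇ im w} (-1)^{|Sᶜ|} = ∑_{U ⊆ (im w)ᶜ} (-1)^{|U|} = [w surjective]`; the surjective self-maps
of `[d]` are the `d!` permutations, each contributing `∏_l y_l`.

Also here: sub-additivity of `tensorRankD` (`tensorRankD_add_le`, `tensorRankD_sum_le`), on top of
`BasicTensorSubspaces.lean` (`tensorRankD_smul_le`, rank-one decompositions of length `trk T`).

## References

* [GargMakamOliveiraWigderson2019] A. Garg, V. Makam, R. Oliveira, A. Wigderson, *More barriers for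
  rank methods, via a "numeric to symbolic" transfer*, FOCS 2019 (arXiv:1904.04299), Ex. 1.5,
  Def. 1.4, Thm. 1.16.
* [EfremenkoGargOliveiraWigderson2018] Def. 4.1, §1.2 (tensor rank is sub-additive).
-/

noncomputable section

open scoped BigOperators
open MvPolynomial

namespace Literature.Computability.AlgebraicComplexity

/-! ## The polarisation identity -/

/-- `∑_{S ⊇ R} (-1)^{|Sᶜ|} = [R = univ]` (inclusion–exclusion over the supersets of `R`).
[folklore] -/
theorem sum_neg_one_pow_card_compl_of_superset {α : Type*} [Fintype α] [DecidableEq α]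
    {K : Type*} [CommRing K] (R : Finset α) :
    ∑ S : Finset α, (if R ⊆ S then (-1 : K) ^ Sᶜ.card else 0) =
      if R = Finset.univ then 1 else 0 := by
  rw [Fintype.sum_bijective _ compl_bijective _
    (fun U : Finset α => if U ⊆ Rᶜ then (-1 : K) ^ U.card else 0) (fun S => by
      by_cases h : R ⊆ S
      · rw [if_pos h, if_pos (Finset.compl_subset_compl.2 h)]
      · rw [if_neg h, if_neg (fun h' => h (by simpa using Finset.compl_subset_compl.2 h'))]),
    ← Finset.sum_filter]
  have hfilter : (Finset.univ.filter fun U : Finset α => U ⊆ Rᶜ) = (Rᶜ).powerset := by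
    ext U
    simp
  have hK : ∑ U ∈ (Rᶜ).powerset, (-1 : K) ^ U.card = if Rᶜ = ∅ then 1 else 0 := by
    have hZ := congrArg (fun z : ℤ => (z : K)) (Finset.sum_powerset_neg_one_pow_card (x := Rᶜ))
    push_cast at hZ
    rw [hZ]
  rw [hfilter, hK]
  simp [Finset.compl_eq_empty_iff]

/-- The self-maps of a finite type with full image are the bijections. [folklore] -/
theorem image_univ_eq_univ_iff_bijective {d : ℕ} (w : Fin d → Fin d) :
    Finset.univ.image w = Finset.univ ↔ Function.Bijective w := by
  classical
  rw [← Finite.surjective_iff_bijective]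
  constructor
  · intro h b
    have hb : b ∈ Finset.univ.image w := by
      rw [h]
      exact Finset.mem_univ b
    obtain ⟨a, -, ha⟩ := Finset.mem_image.1 hb
    exact ⟨a, ha⟩
  · intro h
    exact Finset.image_univ_of_surjective h

/-- The bijective self-maps of `Fin d` number `d!`. [folklore] -/
theorem card_filter_bijective (d : ℕ) :
    (Finset.univ.filter fun w : Fin d → Fin d => Function.Bijective w).card = d.factorial := by
  classical
  have himage : (Finset.univ.filter fun w : Fin d → Fin d => Function.Bijective w) =
      Finset.univ.image fun σ : Equiv.Perm (Fin d) => (σ : Fin d → Fin d) := by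
    ext w
    simp only [Finset.mem_filter, Finset.mem_univ, true_and, Finset.mem_image]
    constructor
    · intro hw
      exact ⟨Equiv.ofBijective w hw, rfl⟩
    · rintro ⟨σ, rfl⟩
      exact σ.bijective
  rw [himage, Finset.card_image_of_injective _ (fun σ τ h => Equiv.coe_fn_injective h),
    Finset.card_univ, Fintype.card_perm, Fintype.card_fin]

/-- **Polarisation identity.** In a commutative ring, for `y₁, …, y_d`:
`∑_{S ⊆ [d]} (-1)^{d - |S|} (∑_{l ∈ S} y_l)^d = d! · ∏_l y_l`. [folklore] -/
theorem sum_neg_one_pow_mul_sum_pow {K : Type*} [CommRing K] {d : ℕ} (y : Fin d → K) :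
    ∑ S : Finset (Fin d), (-1 : K) ^ (d - S.card) * (∑ l ∈ S, y l) ^ d =
      (d.factorial : K) * ∏ l, y l := by
  classical
  -- expand the powers over words `w : Fin d → Fin d` with values in `S`
  have hexp : ∀ S : Finset (Fin d), (∑ l ∈ S, y l) ^ d =
      ∑ w : Fin d → Fin d, if Finset.univ.image w ⊆ S then ∏ q, y (w q) else 0 := by
    intro S
    have hpow : (∑ l ∈ S, y l) ^ d = ∏ _q : Fin d, ∑ l ∈ S, y l := by simp
    rw [hpow, Finset.prod_univ_sum, ← Finset.sum_filter]
    refine Finset.sum_congr ?_ fun w _ => rfl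
    ext w
    simp [Fintype.mem_piFinset, Finset.subset_iff]
  have hcard : ∀ S : Finset (Fin d), d - S.card = Sᶜ.card := fun S => by
    rw [Finset.card_compl, Fintype.card_fin]
  simp_rw [hexp, hcard, Finset.mul_sum, mul_ite, mul_zero]
  rw [Finset.sum_comm]
  -- the inner sum over `S ⊇ im w` is `[w bijective] · ∏ y`
  have hinner : ∀ w : Fin d → Fin d,
      ∑ S : Finset (Fin d), (if Finset.univ.image w ⊆ S then (-1 : K) ^ Sᶜ.card * ∏ q, y (w q)
        else 0) = if Function.Bijective w then ∏ l, y l else 0 := by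
    intro w
    have hfac : ∀ S : Finset (Fin d),
        (if Finset.univ.image w ⊆ S then (-1 : K) ^ Sᶜ.card * ∏ q, y (w q) else 0) =
          (if Finset.univ.image w ⊆ S then (-1 : K) ^ Sᶜ.card else 0) * ∏ q, y (w q) := by
      intro S
      split_ifs <;> simp
    simp_rw [hfac]
    rw [← Finset.sum_mul, sum_neg_one_pow_card_compl_of_superset]
    by_cases hw : Function.Bijective w
    · rw [if_pos ((image_univ_eq_univ_iff_bijective w).2 hw), if_pos hw, one_mul]
      exact Equiv.prod_comp (Equiv.ofBijective w hw) y
    · rw [if_neg (fun h => hw ((image_univ_eq_univ_iff_bijective w).1 h)), if_neg hw, zero_mul]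
  simp_rw [hinner]
  rw [Finset.sum_ite, Finset.sum_const_zero, add_zero, Finset.sum_const, card_filter_bijective,
    nsmul_eq_mul]

/-! ## Products of linear forms as combinations of powers -/

variable {F : Type*} [Field F] {n : ℕ}

/-- `ℓ` is additive in its coefficient vector: `ℓ_{∑ a_l} = ∑ ℓ_{a_l}`. [folklore] -/
theorem linearForm_finset_sum {ι : Type*} (s : Finset ι) (a : ι → Fin n → F) :
    linearForm (∑ l ∈ s, a l) = ∑ l ∈ s, linearForm (a l) := by
  classical
  induction s using Finset.induction_on with
  | empty => simp [linearForm]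
  | insert i s hi ih =>
    rw [Finset.sum_insert hi, Finset.sum_insert hi, ← ih]
    simp only [linearForm, Pi.add_apply, C_add, add_mul]
    rw [Finset.sum_add_distrib]

/-- **A product of `d` linear forms is a combination of `2^d` `d`-th powers of linear forms**
(characteristic zero): `ℓ_{a₁} ⋯ ℓ_{a_d} = (d!)⁻¹ ∑_{S ⊆ [d]} (-1)^{d-|S|} (ℓ_{∑_{l∈S} a_l})^d`.
[cite: GargMakamOliveiraWigderson2019, Ex. 1.5] -/
theorem prod_linearForm_eq_smul_sum [CharZero F] {d : ℕ} (a : Fin d → Fin n → F) :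
    ∏ l, linearForm (a l) = ((d.factorial : F)⁻¹) •
      ∑ S : Finset (Fin d), ((-1 : F) ^ (d - S.card)) • linearForm (∑ l ∈ S, a l) ^ d := by
  have h := sum_neg_one_pow_mul_sum_pow fun l => linearForm (a l)
  have hd : (d.factorial : F) ≠ 0 := Nat.cast_ne_zero.2 (Nat.factorial_ne_zero d)
  simp_rw [← linearForm_finset_sum] at h
  simp_rw [smul_eq_C_mul, map_pow, map_neg, map_one]
  rw [h, ← map_natCast (C : F →+* MvPolynomial (Fin n) F), ← mul_assoc, ← map_mul,
    inv_mul_cancel₀ hd, map_one, one_mul]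

/-! ## Sub-additivity of tensor rank -/

section TensorRank

variable {m k : ℕ}

/-- **Tensor rank is sub-additive**: `trk(A + B) ≤ trk(A) + trk(B)` (`k ≥ 1`; concatenate minimal
decompositions). [cite: EfremenkoGargOliveiraWigderson2018, §1.2] -/
theorem tensorRankD_add_le [NeZero k] (A B : (Fin k → Fin m) → F) :
    tensorRankD (A + B) ≤ tensorRankD A + tensorRankD B := by
  obtain ⟨u, hu⟩ := exists_sum_rankOneTensor_eq_of_tensorRankD_le (le_refl (tensorRankD A))
  obtain ⟨v, hv⟩ := exists_sum_rankOneTensor_eq_of_tensorRankD_le (le_refl (tensorRankD B))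
  refine tensorRankD_le_of_eq_sum (Fin.append u v) ?_
  rw [Fin.sum_univ_add]
  simp [hu, hv]

/-- Tensor rank is sub-additive over finite sums (`k ≥ 1`).
[cite: EfremenkoGargOliveiraWigderson2018, §1.2] -/
theorem tensorRankD_sum_le [NeZero k] {ι : Type*} (s : Finset ι) (T : ι → (Fin k → Fin m) → F) :
    tensorRankD (∑ i ∈ s, T i) ≤ ∑ i ∈ s, tensorRankD (T i) := by
  classical
  induction s using Finset.induction_on with
  | empty => simp
  | insert a s ha ih =>
    rw [Finset.sum_insert ha, Finset.sum_insert ha]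
    exact (tensorRankD_add_le _ _).trans (by gcongr)

/-- **`trk φ(ℓ₁ ⋯ ℓ_d) ≤ 2^d · r`**: a linear map into `k`-tensors (`k ≥ 1`) which sends every
`d`-th power of a linear form to a tensor of rank `≤ r` sends every product of `d` linear forms to a
tensor of rank `≤ 2^d · r` (polarisation, characteristic zero).
[cite: GargMakamOliveiraWigderson2019, Ex. 1.5] -/
theorem tensorRankD_map_prod_linearForm_le [CharZero F] [NeZero k] {d : ℕ}
    (φ : MvPolynomial (Fin n) F →ₗ[F] ((Fin k → Fin m) → F)) {r : ℕ}
    (hr : ∀ a : Fin n → F, tensorRankD (φ (linearForm a ^ d)) ≤ r) (a : Fin d → Fin n → F) :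
    tensorRankD (φ (∏ l, linearForm (a l))) ≤ 2 ^ d * r := by
  rw [prod_linearForm_eq_smul_sum, map_smul, map_sum]
  refine (tensorRankD_smul_le _ _).trans ((tensorRankD_sum_le _ _).trans ?_)
  calc ∑ S : Finset (Fin d),
        tensorRankD (φ (((-1 : F) ^ (d - S.card)) • linearForm (∑ l ∈ S, a l) ^ d))
      ≤ ∑ _S : Finset (Fin d), r := Finset.sum_le_sum fun S _ => by
        rw [map_smul]
        exact (tensorRankD_smul_le _ _).trans (hr _)
    _ = 2 ^ d * r := by simp [Fintype.card_finset]

end TensorRank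

end Literature.Computability.AlgebraicComplexity
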